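import Literature.Probability.LatticeModels.DobrushinDiscArcs
import Literature.Probability.LatticeModels.Sweep1Proofs
import Literature.Analysis.Complex.LindelofMaximumPrinciple
import Mathlib.Analysis.InnerProductSpace.Harmonic.Constructions
import HarnessLib

/-!
# Identification of the limit: a bounded harmonic function with Dobrushin boundary values forces `g² ∝ ψ'/ψ`

Topic `Literature/Probability/LatticeModels` (continuum side); an instalment (item B4 of the road
recorded in `Sweep1Proofs.lean`, module docstring §2b) of the discharge programme for
crit-ising.S18 / Smirnov's Theorem 2.2. This is the uniqueness step at the end of §5 of Smirnov
(2010): the limit `h` of the FK primitives is bounded, harmonic (locally `-κ Im(θ₀² P) + c` with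
`P' = g²`), `0` on the arc `(ab)` and `1` on `(ba)`; transported to the unit disc by the
Carathéodory extension of the uniformizing map (`DobrushinDiscArcs.lean`) and compared with the
harmonic measure `arg(cayley⁻¹ ·)/π`, Lindelöf's maximum principle with the two exceptional points
`±1` (`Literature.Analysis.Complex.harmonic_eq_zero_of_tendsto_frontier_diff_finite`) identifies
`h = ± arg(ψ)/π + const`, whence `κ θ₀² g² = ± π⁻¹ ψ'/ψ` (`kappa_theta_sq_gsq_eq`). Mathlib's
`InnerProductSpace.HarmonicAt` API (`AnalyticAt.harmonicAt_im`) supplies harmonicity. Everything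
is proved.

* `hasDerivAt_zero_of_im_const`, `harmonicAt_of_eq_im`, `discExt_cayley_symm`,
  **`kappa_theta_sq_gsq_eq`**.

## References

* S. Smirnov, Ann. of Math. 172 (2010) 1435–1467, §5 (end of the proof of Thm. 2.2) — bib key
  `Smirnov2010`.
* T. Ransford, *Potential Theory in the Complex Plane* (1995), Thm. 3.6.9 (via the tree file).
-/

noncomputable section

namespace Literature.Probability.LatticeModels

open Set Metric Filter _root_.Topology Complex InnerProductSpace
open Literature.Probability.RandomPlanarGeometry

/-! ### A holomorphic function with constant imaginary part has zero derivative -/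

/-- If `F` is holomorphic on a ball and `Im F` is constant there, then `F' = 0` on the ball
(maximum modulus for `exp(-iF)`, whose modulus `exp(Im F)` is constant). [folklore] -/
theorem hasDerivAt_zero_of_im_const {F F' : ℂ → ℂ} {c : ℂ} {R : ℝ} (hR : 0 < R)
    (hF : ∀ z ∈ ball c R, HasDerivAt F (F' z) z) {m : ℝ} (him : ∀ z ∈ ball c R, (F z).im = m) :
    ∀ z ∈ ball c R, F' z = 0 := by
  set G : ℂ → ℂ := fun z => Complex.exp (-I * F z) with hG
  have hGd : ∀ z ∈ ball c R, HasDerivAt G (Complex.exp (-I * F z) * (-I * F' z)) z :=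
    fun z hz => ((hF z hz).const_mul (-I)).cexp
  have hGdiff : DifferentiableOn ℂ G (ball c R) := fun z hz => (hGd z hz).differentiableAt.differentiableWithinAt
  have hnorm : ∀ z ∈ ball c R, ‖G z‖ = Real.exp m := by
    intro z hz; rw [hG]; simp only [Complex.norm_exp]; congr 1; simp [him z hz]
  have hmax : IsMaxOn (norm ∘ G) (ball c R) c := fun z hz => by
    simp only [Function.comp_apply, mem_setOf_eq, hnorm z hz, hnorm c (mem_ball_self hR)]; exact le_rfl
  have heq := Complex.eqOn_of_isPreconnected_of_isMaxOn_norm (convex_ball c R).isPreconnected isOpen_ball hGdiff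
    (mem_ball_self hR) hmax
  intro z hz
  -- `G` is constant near `z`, so its derivative vanishes
  have hGz : HasDerivAt G 0 z := by
    have : G =ᶠ[𝓝 z] fun _ => G c := by
      filter_upwards [isOpen_ball.mem_nhds hz] with w hw
      exact heq hw
    exact (hasDerivAt_const z (G c)).congr_of_eventuallyEq this
  have h1 := (hGd z hz).unique hGz
  have hexp : Complex.exp (-I * F z) ≠ 0 := Complex.exp_ne_zero _
  have : -I * F' z = 0 := by
    rcases mul_eq_zero.1 h1 with h | h
    · exact absurd h hexp
    · exact h
  simpa using this

/-! ### Harmonicity of locally-`Im`-holomorphic functions -/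

/-- A function that near `z` equals `a + b · Im (Q w)` with `Q` holomorphic near `z` is harmonic at
`z`. [folklore] -/
theorem harmonicAt_of_eq_im {f : ℂ → ℝ} {Q : ℂ → ℂ} {z : ℂ} {U : Set ℂ} (hU : IsOpen U) (hz : z ∈ U)
    (hQ : DifferentiableOn ℂ Q U) {a b : ℝ} (hf : ∀ w ∈ U, f w = a + b * (Q w).im) : HarmonicAt f z := by
  have hQa : AnalyticAt ℂ Q z := hQ.analyticAt (hU.mem_nhds hz)
  have h1 : HarmonicAt (fun w => (Q w).im) z := hQa.harmonicAt_im
  have h2 : HarmonicAt (fun w => a + b * (Q w).im) z := by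
    have h1' : HarmonicAt (b • fun w => (Q w).im) z := h1.const_smul
    have := (harmonicAt_const (E := ℂ) a).add h1'
    simpa [Pi.add_def, Pi.smul_def, smul_eq_mul] using this
  exact (harmonicAt_congr_nhds (by filter_upwards [hU.mem_nhds hz] with w hw; exact hf w hw)).2 h2

/-! ### The identification theorem -/

section Identify

variable {D : RandomPlanarGeometry.DobrushinDomain}

/-- For `z ∈ D`, the point `cayley (ψ z)` of the disc is mapped back to `z` by the disc extension.
[folklore] -/
theorem discExt_cayley_symm {φ : ConformalEquiv UpperHalfPlane.upperHalfPlaneSet D.carrier} {Φ : ℂ → ℂ}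
    (h : JordanDomain.IsDiscExtension D.toJordanDomain φ Φ) {z : ℂ} (hz : z ∈ D.carrier) :
    cayleyFun (φ.symm z) ∈ ball (0 : ℂ) 1 ∧ Φ (cayleyFun (φ.symm z)) = z := by
  have hψ : φ.symm z ∈ UpperHalfPlane.upperHalfPlaneSet := φ.symm_mapsTo hz
  have hw : cayleyFun (φ.symm z) ∈ ball (0 : ℂ) 1 := cayley.mapsTo hψ
  refine ⟨hw, ?_⟩
  rw [h.eqOn hw]
  simp only [ConformalEquiv.trans_apply, cayley_symm_apply]
  have him : 0 < (φ.symm z).im := hψ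
  rw [cayleyInvFun_cayleyFun (add_I_ne_zero him.le), φ.apply_symm_apply hz]

/-- **Identification of the limit** (Smirnov 2010, end of §5). Let `g` be holomorphic on the
Dobrushin domain `(D; a, b)` and `h : D → [0,1]` be locally of the form
`h z = h z₁ - κ Im(θ₀² (P z - P z₁))` with `P' = g²`, tending to `0` at the points of the open arc
`(ab)` and to `1` at the points of the open arc `(ba)`. Then, for a chordal uniformizing map
`φ : ℍ → D` with inverse `ψ`, `κ θ₀² g² = ± π⁻¹ ψ'/ψ` on `D`. Proof: transport to the unit disc by
the Carathéodory extension `Φ` of `φ ∘ cayley⁻¹` (`DobrushinDiscArcs.lean`); `h ∘ Φ` minus the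
harmonic measure `arg(cayley⁻¹ ·)/π` (or its complement, according to which semicircle goes to
which arc) is bounded, harmonic, and tends to `0` at every point of the circle other than `±1`, so
it vanishes (`harmonic_eq_zero_of_tendsto_frontier_diff_finite`); hence `h = ± arg(ψ)/π + const`
on `D`, `Im(κ θ₀² P ± π⁻¹ log ψ)` is locally constant, and its derivative vanishes.
[cite: Smirnov2010, §5 (end of the proof of Theorem 2.2)] -/
theorem kappa_theta_sq_gsq_eq {g : ℂ → ℂ} {θ₀ : ℂ} {κ : ℝ} {h : ℂ → ℝ}
    (hloc : ∀ z₁ ∈ D.carrier, ∃ R > 0, ball z₁ R ⊆ D.carrier ∧ ∃ P : ℂ → ℂ, (∀ z ∈ ball z₁ R, HasDerivAt P (g z ^ 2) z) ∧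
      ∀ z ∈ ball z₁ (R / 4), h z = h z₁ - κ * (θ₀ ^ 2 * (P z - P z₁)).im)
    (h01 : ∀ z ∈ D.carrier, h z ∈ Icc (0 : ℝ) 1)
    (hbdA : ∀ p ∈ D.arc 0, p ∉ D.arc 1 → ∀ η > 0, ∃ ρ > 0, ∀ z ∈ D.carrier, dist z p < ρ → h z ≤ η)
    (hbdB : ∀ p ∈ D.arc 1, p ∉ D.arc 0 → ∀ η > 0, ∃ ρ > 0, ∀ z ∈ D.carrier, dist z p < ρ → 1 - η ≤ h z)
    (φ : ConformalEquiv UpperHalfPlane.upperHalfPlaneSet D.carrier) (hφ : D.IsChordalUniformizing φ) :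
    ∃ ε : ℝ, (ε = 1 ∨ ε = -1) ∧ ∀ z ∈ D.carrier,
      (κ : ℂ) * θ₀ ^ 2 * g z ^ 2 = ((ε / Real.pi : ℝ) : ℂ) * (deriv φ.symm z / φ.symm z) := by
  classical
  -- the disc extension and where the semicircles go
  obtain ⟨Φ, hd⟩ := exists_discExt φ
  obtain ⟨s, hs0, hs1⟩ := exists_semicircle_arcs hd hφ
  -- the comparison function on the disc: `ϖ` if the lower semicircle goes to `(ab)`, else `1 - ϖ`
  -- (`s = true` means the upper semicircle goes to `(ab)`)
  set cmp : ℂ → ℝ := fun w => if s then 1 - discArgFrac w else discArgFrac w with hcmp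
  set u : ℂ → ℝ := fun w => h (Φ w) - cmp w with hu
  -- harmonicity on the disc
  have hΦd : DifferentiableOn ℂ Φ (ball (0 : ℂ) 1) := by
    have : DifferentiableOn ℂ (cayley.symm.trans φ) (ball (0 : ℂ) 1) := (cayley.symm.trans φ).differentiableOn
    exact this.congr fun w hw => hd.eqOn hw
  have hΦD : ∀ w ∈ ball (0 : ℂ) 1, Φ w ∈ D.carrier := fun w hw => discExt_mem_carrier hd hw
  have hharm : HarmonicOnNhd u (ball (0 : ℂ) 1) := by
    intro w₀ hw₀
    -- `h ∘ Φ` near `w₀`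
    obtain ⟨R, hR, hRD, P, hP, hlocal⟩ := hloc (Φ w₀) (hΦD w₀ hw₀)
    have hcont : ContinuousAt Φ w₀ := (hΦd.continuousOn w₀ hw₀).continuousAt (isOpen_ball.mem_nhds hw₀)
    obtain ⟨r₁, hr₁, hr₁sub⟩ : ∃ r₁ > 0, ball w₀ r₁ ⊆ ball (0 : ℂ) 1 ∧ ∀ w ∈ ball w₀ r₁, Φ w ∈ ball (Φ w₀) (R / 4) := by
      have h1 : ∀ᶠ w in 𝓝 w₀, Φ w ∈ ball (Φ w₀) (R / 4) := hcont (ball_mem_nhds _ (by positivity))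
      have h2 : ∀ᶠ w in 𝓝 w₀, w ∈ ball (0 : ℂ) 1 := isOpen_ball.mem_nhds hw₀
      obtain ⟨r₁, hr₁, hsub⟩ := Metric.eventually_nhds_iff_ball.1 (h1.and h2)
      exact ⟨r₁, hr₁, fun w hw => (hsub w hw).2, fun w hw => (hsub w hw).1⟩
    have hPd : DifferentiableOn ℂ P (ball (Φ w₀) R) := fun z hz => (hP z hz).differentiableAt.differentiableWithinAt
    have hQ : DifferentiableOn ℂ (fun w => θ₀ ^ 2 * P (Φ w)) (ball w₀ r₁) := by
      refine DifferentiableOn.const_mul ?_ _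
      exact hPd.comp (hΦd.mono hr₁sub.1) fun w hw => ball_subset_ball (by linarith) (hr₁sub.2 w hw)
    have hhΦ : HarmonicAt (fun w => h (Φ w)) w₀ := by
      refine harmonicAt_of_eq_im isOpen_ball (mem_ball_self hr₁) hQ (a := h (Φ w₀) + κ * (θ₀ ^ 2 * P (Φ w₀)).im) (b := -κ)
        fun w hw => ?_
      rw [hlocal (Φ w) (hr₁sub.2 w hw), mul_sub, Complex.sub_im]; ring
    -- the comparison function
    have hcmpH : HarmonicAt cmp w₀ := by
      have hϖ : HarmonicAt discArgFrac w₀ := by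
        refine harmonicAt_of_eq_im isOpen_ball hw₀ differentiableOn_log_cayleyInv (a := 0) (b := 1) fun w _ => ?_
        rw [discArgFrac_eq_im]; ring
      rw [hcmp]
      cases s
      · simpa using hϖ
      · simp only [if_true]
        have := (harmonicAt_const (E := ℂ) (1 : ℝ)).sub hϖ
        simpa [Pi.sub_def] using this
    exact hhΦ.sub hcmpH
  -- boundedness
  have hbound : ∀ w ∈ ball (0 : ℂ) 1, |u w| ≤ 2 := by
    intro w hw
    have h1 := h01 (Φ w) (hΦD w hw)
    have h2 := discArgFrac_mem_Icc_of_mem_ball hw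
    rw [hu]; simp only
    rw [abs_le]
    rw [hcmp]; split_ifs <;> constructor <;> linarith [h1.1, h1.2, h2.1, h2.2]
  -- boundary values on the circle minus `±1`
  have hbdry : ∀ ζ ∈ frontier (ball (0 : ℂ) 1), ζ ∉ ({1, -1} : Set ℂ) → Tendsto u (𝓝[ball (0 : ℂ) 1] ζ) (𝓝 0) := by
    intro ζ hζ hζE
    rw [frontier_ball (0 : ℂ) one_ne_zero, mem_sphere_zero_iff_norm] at hζ
    simp only [mem_insert_iff, mem_singleton_iff, not_or] at hζE
    have him : ζ.im ≠ 0 := by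
      intro him
      have h2 : ζ.re ^ 2 = 1 := by
        have := Complex.sq_norm ζ; rw [hζ, Complex.normSq_apply, him] at this; nlinarith [this]
      have : (ζ.re - 1) * (ζ.re + 1) = 0 := by nlinarith
      rcases mul_eq_zero.1 this with h' | h'
      · exact hζE.1 (Complex.ext (by simp; linarith) (by simp [him]))
      · exact hζE.2 (Complex.ext (by simp; linarith) (by simp [him]))
    -- transfer of the boundary values of `h` to `h ∘ Φ`
    have htrans : ∀ (L : ℝ), (∀ η > 0, ∃ ρ > 0, ∀ z ∈ D.carrier, dist z (Φ ζ) < ρ → |h z - L| ≤ η) →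
        Tendsto (fun w => h (Φ w)) (𝓝[ball (0 : ℂ) 1] ζ) (𝓝 L) := by
      intro L hL
      rw [Metric.tendsto_nhdsWithin_nhds]
      intro ε hε
      obtain ⟨ρ, hρ, hρb⟩ := hL (ε / 2) (by positivity)
      obtain ⟨V, hV, hVb⟩ := discExt_transfer hd hζ hρ (fun z hz hzd => hρb z hz hzd)
      obtain ⟨δ, hδ, hδV⟩ := Metric.mem_nhds_iff.1 hV
      refine ⟨δ, hδ, fun w hw hwd => ?_⟩
      have := hVb w ⟨hδV hwd, hw⟩
      rw [Real.dist_eq]; linarith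
    -- which arc does `Φ ζ` lie on?
    rcases lt_or_gt_of_ne him with hneg | hpos
    · -- lower semicircle
      have hζmem : ζ ∈ semicircle false := ⟨hζ, by simpa using hneg⟩
      have hϖ := tendsto_discArgFrac_lower hζ hneg
      cases s
      · -- lower semicircle goes to `(ab)`: `h → 0`, `cmp = ϖ → 0`
        obtain ⟨h0, h1⟩ := hs0 ζ hζmem
        have hh : Tendsto (fun w => h (Φ w)) (𝓝[ball (0 : ℂ) 1] ζ) (𝓝 0) := by
          refine htrans 0 fun η hη => ?_
          obtain ⟨ρ, hρ, hb⟩ := hbdA _ h0 h1 η hη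
          exact ⟨ρ, hρ, fun z hz hzd => by rw [sub_zero, abs_of_nonneg (h01 z hz).1]; exact hb z hz hzd⟩
        have := hh.sub hϖ
        rw [sub_zero] at this
        refine this.congr fun w => ?_
        simp [hu, hcmp]
      · -- lower semicircle goes to `(ba)`: `h → 1`, `cmp = 1 - ϖ → 1`
        obtain ⟨h1, h0⟩ := hs1 ζ (by simpa using hζmem)
        have hh : Tendsto (fun w => h (Φ w)) (𝓝[ball (0 : ℂ) 1] ζ) (𝓝 1) := by
          refine htrans 1 fun η hη => ?_
          obtain ⟨ρ, hρ, hb⟩ := hbdB _ h1 h0 η hη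
          refine ⟨ρ, hρ, fun z hz hzd => ?_⟩
          rw [abs_le]; constructor <;> linarith [hb z hz hzd, (h01 z hz).2]
        have := hh.sub ((tendsto_const_nhds (x := (1 : ℝ))).sub hϖ)
        rw [sub_zero, sub_self] at this
        refine this.congr fun w => ?_
        simp [hu, hcmp]
    · -- upper semicircle
      have hζmem : ζ ∈ semicircle true := ⟨hζ, by simpa using hpos⟩
      have hϖ := tendsto_discArgFrac_upper hζ hpos
      cases s
      · -- upper semicircle goes to `(ba)`: `h → 1`, `cmp = ϖ → 1`
        obtain ⟨h1, h0⟩ := hs1 ζ (by simpa using hζmem)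
        have hh : Tendsto (fun w => h (Φ w)) (𝓝[ball (0 : ℂ) 1] ζ) (𝓝 1) := by
          refine htrans 1 fun η hη => ?_
          obtain ⟨ρ, hρ, hb⟩ := hbdB _ h1 h0 η hη
          refine ⟨ρ, hρ, fun z hz hzd => ?_⟩
          rw [abs_le]; constructor <;> linarith [hb z hz hzd, (h01 z hz).2]
        have := hh.sub hϖ
        rw [sub_self] at this
        refine this.congr fun w => ?_
        simp [hu, hcmp]
      · -- upper semicircle goes to `(ab)`: `h → 0`, `cmp = 1 - ϖ → 0`
        obtain ⟨h0, h1⟩ := hs0 ζ hζmem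
        have hh : Tendsto (fun w => h (Φ w)) (𝓝[ball (0 : ℂ) 1] ζ) (𝓝 0) := by
          refine htrans 0 fun η hη => ?_
          obtain ⟨ρ, hρ, hb⟩ := hbdA _ h0 h1 η hη
          exact ⟨ρ, hρ, fun z hz hzd => by rw [sub_zero, abs_of_nonneg (h01 z hz).1]; exact hb z hz hzd⟩
        have := hh.sub ((tendsto_const_nhds (x := (1 : ℝ))).sub hϖ)
        rw [sub_self, sub_zero] at this
        refine this.congr fun w => ?_
        simp [hu, hcmp]
  -- Lindelöf: `u = 0` on the disc
  have hu0 := Literature.Analysis.Complex.harmonic_eq_zero_of_tendsto_frontier_diff_finite isOpen_ball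
    (convex_ball (0 : ℂ) 1).isPreconnected isBounded_ball (E := {1, -1}) (Set.toFinite _)
    (by intro e he; simp only [mem_insert_iff, mem_singleton_iff] at he; rcases he with rfl | rfl <;> simp) hharm hbound hbdry
  -- back on `D`: `h z = cmp (cayley (ψ z))`, i.e. `h = ± arg(ψ z)/π + const`
  set ε' : ℝ := if s then -1 else 1 with hε'
  set c' : ℝ := if s then 1 else 0 with hc'
  have hform : ∀ z ∈ D.carrier, h z = c' + ε' * ((Complex.log (φ.symm z)).im / Real.pi) := by
    intro z hz
    obtain ⟨hw, hΦw⟩ := discExt_cayley_symm hd hz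
    have h0 := hu0 _ hw
    rw [hu] at h0; simp only at h0
    rw [hΦw, sub_eq_zero] at h0
    rw [h0, hcmp]
    have him : 0 < (φ.symm z).im := φ.symm_mapsTo hz
    have harg : discArgFrac (cayleyFun (φ.symm z)) = Complex.arg (φ.symm z) / Real.pi := by
      rw [discArgFrac, cayleyInvFun_cayleyFun (add_I_ne_zero him.le)]
    simp only [harg, Complex.log_im]
    rw [hε', hc']; split_ifs <;> ring
  -- the sign of the statement
  refine ⟨-ε', by rw [hε']; split_ifs <;> norm_num, fun z₁ hz₁ => ?_⟩
  obtain ⟨R, hR, hRD, P, hP, hlocal⟩ := hloc z₁ hz₁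
  -- `F = κ θ₀² P + (ε'/π) log ψ` has constant imaginary part on `ball z₁ (R/4)`
  set F : ℂ → ℂ := fun z => (κ : ℂ) * (θ₀ ^ 2 * P z) + ((ε' / Real.pi : ℝ) : ℂ) * Complex.log (φ.symm z) with hF
  have hψd : DifferentiableOn ℂ φ.symm D.carrier := φ.differentiableOn_symm
  have hFd : ∀ z ∈ ball z₁ (R / 4), HasDerivAt F ((κ : ℂ) * (θ₀ ^ 2 * g z ^ 2) +
      ((ε' / Real.pi : ℝ) : ℂ) * (deriv φ.symm z / φ.symm z)) z := by
    intro z hz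
    have hzD : z ∈ D.carrier := hRD (ball_subset_ball (by linarith) hz)
    have hPz := hP z (ball_subset_ball (by linarith) hz)
    have hψz : HasDerivAt φ.symm (deriv φ.symm z) z := (hψd.differentiableAt (D.isOpen.mem_nhds hzD)).hasDerivAt
    have him : 0 < (φ.symm z).im := φ.symm_mapsTo hzD
    have hlog := hψz.clog (Or.inr him.ne')
    exact ((hPz.const_mul (θ₀ ^ 2)).const_mul (κ : ℂ)).add (hlog.const_mul _)
  have hFim : ∀ z ∈ ball z₁ (R / 4), (F z).im = h z₁ + κ * (θ₀ ^ 2 * P z₁).im - c' := by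
    intro z hz
    have hzD : z ∈ D.carrier := hRD (ball_subset_ball (by linarith) hz)
    have e1 := hlocal z hz
    have e2 := hform z hzD
    rw [hF]; simp only [Complex.add_im, Complex.im_ofReal_mul]
    rw [mul_sub, Complex.sub_im] at e1
    have e3 : ε' / Real.pi * (Complex.log (φ.symm z)).im = ε' * ((Complex.log (φ.symm z)).im / Real.pi) := by ring
    linarith [e1, e2, e3]
  have hzero := hasDerivAt_zero_of_im_const (by positivity : (0 : ℝ) < R / 4) hFd hFim z₁ (mem_ball_self (by positivity))
  -- rearrange
  have : (κ : ℂ) * θ₀ ^ 2 * g z₁ ^ 2 = -(((ε' / Real.pi : ℝ) : ℂ) * (deriv φ.symm z₁ / φ.symm z₁)) := by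
    rw [← mul_assoc] at hzero; linear_combination hzero
  rw [this, show ((-ε' / Real.pi : ℝ) : ℂ) = -((ε' / Real.pi : ℝ) : ℂ) by push_cast; ring]
  ring

end Identify

end Literature.Probability.LatticeModels
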